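import Summits.AtomisticToContinuum.FouriersLaw.Theorems.BondHeatUncertaintyExtensiveSnapshotIrreversibilityEnergyWindowExcessFilter
import Summits.AtomisticToContinuum.FouriersLaw.Theorems.BondHeatUncertaintyExtensiveSnapshotIrreversibilityEnergyWindowDivergenceFilter

/-!
# Crux `ExtensiveSnapshotIrreversibility` (stmt-AtomisticToContinuum-9121), fixed-`N` half `K_fix`:
the graded RUNGS of the uniform-integrability scale — moment decay `(m, a)`, `a > 2`, and
moment × concentration
(node «UniformIntegrabilityLadder», 3/4)

(helper file, theorem-side; decomp-a2c lens-1 «grading / quantitative ladder», generation 90.)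

Along a family of tilts `μ_δ = μ₀ · e^{φ_δ}`, `ψ_δ := φ_δ − φ_δ∘Θ`, the uniform-integrability scale
(UI) `∫_{|ψ_δ|>η} |ψ_δ| dμ_δ ≤ ε δ²` eventually (every `η, ε > 0`; `…EnergyWindowExcessFilter`) is
reached from two graded inputs:

* ★ `setIntegral_abs_mul_exp_le_of_rpow_moment` — MOMENT DECAY `(m, a)`, `m ≥ 1`, `a > 2`:
  `∫ |ψ_δ|ᵐ dμ_δ ≤ C |δ|ᵃ` ⟹ (UI) (Chebyshev on the level set,
  `mul_setIntegral_abs_mul_exp_le_integral_rpow`: `η^{m−1} ∫_{|ψ|>η} |ψ| dμ ≤ ∫ |ψ|ᵐ dμ`, and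
  `|δ|ᵃ = |δ|^{a−2} · δ²` with `a − 2 > 0`).  The natural LINEAR size is `a = m` (`ψ_δ = O(δ)` in
  `Lᵐ`), which needs `m > 2`; the rate `a = 2` is the threshold: `∫ ψ_δ² dμ_δ ≤ C δ²` allows a
  level-set tail of exact order `δ²` (two-point tilts), so `a > 2` is sharp for this rung;
* ★ `setIntegral_abs_mul_exp_le_of_moment_of_concentration` — generation 89's pair: a moment
  bound `∫ |ψ_δ|ᵖ dμ_δ ≤ C₂ |δ|^{−r}` (`p > 1`, polynomial blow-up allowed) and superpolynomial
  concentration `μ_δ(|ψ_δ| > η) ≤ |δ|ˢ` (every `s`) ⟹ (UI) (Young on the level set,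
  `setIntegral_abs_mul_exp_le_young`, weight `λ = |δ|^{(r⁺+3)/p}`: the tail is `O(|δ|³)`).

Both are stated ONE STATE AT A TIME (the NESS atoms quantify over every representing exponent
`φ`; the eventual smallness of the constants is `eventually_mul_rpow_abs_lt` /
`eventually_mul_abs_lt`).  So the tail clause of the divergence-ladder junction (A2ₚ ∧ SPC) and the
moment-decay clause both factor through the single NECESSARY atom (UI)
(`…EnergyWindowExcessAtoms`, `…EnergyWindowExcessRungs`).  No new objects. [folklore]
-/

noncomputable section

namespace Summit.AtomisticToContinuum.FouriersLaw.Theorems.ExtensiveSnapshotIrreversibility.EnergyWindow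

open MeasureTheory Filter Topology InformationTheory Real
open scoped ENNReal NNReal
open Literature.MathematicalPhysics.KineticTheory.HeatConduction
open Summit.AtomisticToContinuum.FouriersLaw.Theorems.ExtensiveSnapshotIrreversibility.Negative
open Summit.AtomisticToContinuum.FouriersLaw.Theorems.ExtensiveSnapshotIrreversibility.ClausiusBudget.OddLogDensity

variable {N : ℕ}

section Tails

variable (μ₀ : Measure (PhaseSpace N))

/-- **Chebyshev on the level set.** For `m ≥ 1`, `η > 0` and a tilt with `|ψ|ᵐ e^{φ} ∈ L¹(μ₀)`
(`ψ = φ − φ∘Θ`): `|ψ| e^{φ} ∈ L¹(μ₀)` (`|ψ| ≤ 1 + |ψ|ᵐ`) and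
`η^{m−1} ∫_{|ψ|>η} |ψ| e^{φ} dμ₀ ≤ ∫ |ψ|ᵐ e^{φ} dμ₀` (`η^{m−1} |ψ| ≤ |ψ|ᵐ` on the level set).
[folklore] -/
theorem mul_setIntegral_abs_mul_exp_le_integral_rpow {m η : ℝ} (hm : 1 ≤ m) (hη : 0 < η)
    {φ : PhaseSpace N → ℝ} (hφm : Measurable φ) (hexp : Integrable (fun x => exp (φ x)) μ₀)
    (hTm : Integrable (fun x => |φ x - φ (x.1, -x.2)| ^ m * exp (φ x)) μ₀) :
    Integrable (fun x => |φ x - φ (x.1, -x.2)| * exp (φ x)) μ₀ ∧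
      η ^ (m - 1) * ∫ x in {x | η < |φ x - φ (x.1, -x.2)|}, |φ x - φ (x.1, -x.2)| * exp (φ x) ∂μ₀ ≤
        ∫ x, |φ x - φ (x.1, -x.2)| ^ m * exp (φ x) ∂μ₀ := by
  have hΘm : Measurable (fun x : PhaseSpace N => (x.1, -x.2)) := (momentumReversal N).measurable
  have hψm : Measurable (fun x => φ x - φ (x.1, -x.2)) := hφm.sub (hφm.comp hΘm)
  -- `y ≤ 1 + yᵐ` for `y ≥ 0`, `m ≥ 1`
  have hpt : ∀ y : ℝ, 0 ≤ y → y ≤ 1 + y ^ m := by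
    intro y hy
    rcases le_total y 1 with h | h
    · linarith [Real.rpow_nonneg hy m]
    · have h1 : y ^ (1 : ℝ) ≤ y ^ m := Real.rpow_le_rpow_of_exponent_le h hm
      rw [Real.rpow_one] at h1
      linarith
  have h1 : Integrable (fun x => |φ x - φ (x.1, -x.2)| * exp (φ x)) μ₀ := by
    refine (hexp.add hTm).mono' (hψm.abs.mul hφm.exp).aestronglyMeasurable
      (ae_of_all _ fun x => ?_)
    rw [Real.norm_eq_abs, abs_of_nonneg (by positivity)]
    have h := mul_le_mul_of_nonneg_right (hpt _ (abs_nonneg (φ x - φ (x.1, -x.2))))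
      (exp_pos (φ x)).le
    simp only [Pi.add_apply]
    linarith
  refine ⟨h1, ?_⟩
  have hA : MeasurableSet {x : PhaseSpace N | η < |φ x - φ (x.1, -x.2)|} :=
    measurableSet_lt measurable_const hψm.abs
  rw [← integral_const_mul]
  calc ∫ x in {x | η < |φ x - φ (x.1, -x.2)|}, η ^ (m - 1) * (|φ x - φ (x.1, -x.2)| * exp (φ x)) ∂μ₀
      ≤ ∫ x in {x | η < |φ x - φ (x.1, -x.2)|}, |φ x - φ (x.1, -x.2)| ^ m * exp (φ x) ∂μ₀ := by
        refine setIntegral_mono_on (h1.const_mul _).integrableOn hTm.integrableOn hA fun x hx => ?_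
        have hx' : η < |φ x - φ (x.1, -x.2)| := hx
        set y : ℝ := |φ x - φ (x.1, -x.2)| with hy
        have hypos : 0 < y := hη.trans hx'
        have hpow : η ^ (m - 1) ≤ y ^ (m - 1) := Real.rpow_le_rpow hη.le hx'.le (by linarith)
        have hsplit : y ^ m = y ^ (m - 1) * y := by
          rw [← Real.rpow_add_one hypos.ne' (m - 1)]
          ring_nf
        rw [hsplit]
        have := mul_le_mul_of_nonneg_right hpow (mul_nonneg hypos.le (exp_pos (φ x)).le)
        linarith [this]
    _ ≤ ∫ x, |φ x - φ (x.1, -x.2)| ^ m * exp (φ x) ∂μ₀ :=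
        setIntegral_le_integral hTm (ae_of_all _ fun x => by positivity)

/-- `|δ| → 0` along `δ → 0`, `δ ≠ 0`. [folklore] -/
theorem tendsto_abs_nhdsWithin_zero : Tendsto (fun δ : ℝ => |δ|) (𝓝[≠] (0 : ℝ)) (𝓝 0) := by
  have h := (continuous_abs.tendsto (0 : ℝ))
  rw [abs_zero] at h
  exact h.mono_left nhdsWithin_le_nhds

/-- Eventually in `δ ≠ 0`: `C |δ|ᵃ < b` (`a, b > 0`). [folklore] -/
theorem eventually_mul_rpow_abs_lt {a b : ℝ} (ha : 0 < a) (hb : 0 < b) (C : ℝ) :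
    ∀ᶠ δ in 𝓝[≠] (0 : ℝ), C * |δ| ^ a < b := by
  have hpow : Tendsto (fun δ : ℝ => |δ| ^ a) (𝓝[≠] (0 : ℝ)) (𝓝 0) := by
    have h := ((Real.continuousAt_rpow_const 0 a (Or.inr ha.le)).tendsto).comp
      tendsto_abs_nhdsWithin_zero
    rwa [Real.zero_rpow ha.ne'] at h
  have h := hpow.const_mul C
  rw [mul_zero] at h
  exact h.eventually_lt_const hb

/-- Eventually in `δ ≠ 0`: `C |δ| < b` (`b > 0`). [folklore] -/
theorem eventually_mul_abs_lt {b : ℝ} (hb : 0 < b) (C : ℝ) :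
    ∀ᶠ δ in 𝓝[≠] (0 : ℝ), C * |δ| < b := by
  have h := tendsto_abs_nhdsWithin_zero.const_mul C
  rw [mul_zero] at h
  exact h.eventually_lt_const hb

/-- ★ **RUNG (one state): a moment of order `m ≥ 1` decaying at rate `|δ|ᵃ`, `a > 2`, gives the
uniform-integrability scale.**  For a tilt `μ₀ · e^{φ}` with `|ψ|ᵐ e^{φ} ∈ L¹(μ₀)` and
`∫ |ψ|ᵐ e^{φ} dμ₀ ≤ C |δ|ᵃ` at a `δ ≠ 0` with `C⁺ |δ|^{a−2} ≤ η^{m−1} ε` (true eventually when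
`a > 2`, `eventually_mul_rpow_abs_lt`): `|ψ| e^{φ} ∈ L¹(μ₀)` and `∫_{|ψ|>η} |ψ| e^{φ} dμ₀ ≤ ε δ²`
(Chebyshev, `mul_setIntegral_abs_mul_exp_le_integral_rpow`).  The linear size `a = m` needs
`m > 2`; `a = 2` is the threshold (a moment bound `≤ C δ²` allows a level-set tail of exact order
`δ²`: two-point tilts). [folklore] -/
theorem setIntegral_abs_mul_exp_le_of_rpow_moment {m a C η ε δ : ℝ} (hm : 1 ≤ m) (hη : 0 < η)
    (hδ : δ ≠ 0) (hsmall : max C 0 * |δ| ^ (a - 2) ≤ η ^ (m - 1) * ε)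
    {φ : PhaseSpace N → ℝ} (hφm : Measurable φ) (hexp : Integrable (fun x => exp (φ x)) μ₀)
    (hM : Integrable (fun x => |φ x - φ (x.1, -x.2)| ^ m * exp (φ x)) μ₀ ∧
      ∫ x, |φ x - φ (x.1, -x.2)| ^ m * exp (φ x) ∂μ₀ ≤ C * |δ| ^ a) :
    Integrable (fun x => |φ x - φ (x.1, -x.2)| * exp (φ x)) μ₀ ∧
      ∫ x in {x | η < |φ x - φ (x.1, -x.2)|}, |φ x - φ (x.1, -x.2)| * exp (φ x) ∂μ₀ ≤
        ε * δ ^ 2 := by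
  have hC'0 : 0 ≤ max C 0 := le_max_right _ _
  have hCC' : C ≤ max C 0 := le_max_left _ _
  have hηm : 0 < η ^ (m - 1) := Real.rpow_pos_of_pos hη _
  have hδ0 : 0 < |δ| := abs_pos.2 hδ
  obtain ⟨h1, hcheb⟩ := mul_setIntegral_abs_mul_exp_le_integral_rpow μ₀ hm hη hφm hexp hM.1
  refine ⟨h1, ?_⟩
  have hsplit : |δ| ^ a = |δ| ^ (a - 2) * δ ^ 2 := by
    have e : a = a - 2 + 2 := by ring
    rw [e, Real.rpow_add hδ0, Real.rpow_two, sq_abs]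
    ring_nf
  have hchain : η ^ (m - 1) * ∫ x in {x | η < |φ x - φ (x.1, -x.2)|},
      |φ x - φ (x.1, -x.2)| * exp (φ x) ∂μ₀ ≤ η ^ (m - 1) * (ε * δ ^ 2) :=
    calc η ^ (m - 1) * ∫ x in {x | η < |φ x - φ (x.1, -x.2)|},
          |φ x - φ (x.1, -x.2)| * exp (φ x) ∂μ₀
        ≤ ∫ x, |φ x - φ (x.1, -x.2)| ^ m * exp (φ x) ∂μ₀ := hcheb
      _ ≤ C * |δ| ^ a := hM.2
      _ ≤ max C 0 * |δ| ^ a := mul_le_mul_of_nonneg_right hCC' (Real.rpow_nonneg hδ0.le _)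
      _ = max C 0 * |δ| ^ (a - 2) * δ ^ 2 := by rw [hsplit]; ring
      _ ≤ η ^ (m - 1) * ε * δ ^ 2 := mul_le_mul_of_nonneg_right hsmall (sq_nonneg δ)
      _ = η ^ (m - 1) * (ε * δ ^ 2) := by ring
  exact le_of_mul_le_mul_left hchain hηm

/-- ★ **RUNG (one state): moment × superpolynomial concentration gives the uniform-integrability
scale** (generation 89's tail pair).  For a tilt `μ₀ · e^{φ}` and Hölder conjugate `p, q`, at a
`δ ≠ 0` with `|δ| < 1` and `(C₂⁺/p + 1/q) |δ| ≤ ε` (true eventually, `eventually_mul_abs_lt`):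
(T2ₚ) `∫ |ψ|ᵖ e^{φ} dμ₀ ≤ C₂ |δ|^{−r}` and (SPC at order `s = (r⁺+3)q/p + 3`)
`∫_{|ψ|>η} e^{φ} dμ₀ ≤ |δ|ˢ` give `|ψ| e^{φ} ∈ L¹(μ₀)` and `∫_{|ψ|>η} |ψ| e^{φ} dμ₀ ≤ ε δ²` (Young
on the level set, `setIntegral_abs_mul_exp_le_young`, weight `λ = |δ|^{(r⁺+3)/p}`: the tail is at
most `(C₂⁺/p + 1/q) |δ|³`). [folklore] -/
theorem setIntegral_abs_mul_exp_le_of_moment_of_concentration {C₂ r p q η ε δ : ℝ}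
    (hpq : p.HolderConjugate q) (hδ : δ ≠ 0) (hδ1 : |δ| < 1)
    (hsmall : (max C₂ 0 / p + 1 / q) * |δ| ≤ ε)
    {φ : PhaseSpace N → ℝ} (hφm : Measurable φ) (hexp : Integrable (fun x => exp (φ x)) μ₀)
    (hT2 : Integrable (fun x => |φ x - φ (x.1, -x.2)| ^ p * exp (φ x)) μ₀ ∧
      ∫ x, |φ x - φ (x.1, -x.2)| ^ p * exp (φ x) ∂μ₀ ≤ C₂ * |δ| ^ (-r))
    (hS : ∫ x in {x | η < |φ x - φ (x.1, -x.2)|}, exp (φ x) ∂μ₀ ≤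
      |δ| ^ ((max r 0 + 3) * q / p + 3)) :
    Integrable (fun x => |φ x - φ (x.1, -x.2)| * exp (φ x)) μ₀ ∧
      ∫ x in {x | η < |φ x - φ (x.1, -x.2)|}, |φ x - φ (x.1, -x.2)| * exp (φ x) ∂μ₀ ≤
        ε * δ ^ 2 := by
  have hp : 0 < p := hpq.pos
  have hq : 0 < q := hpq.symm.pos
  set r' : ℝ := max r 0 with hr'
  have hrr' : r ≤ r' := le_max_left _ _
  set s : ℝ := (r' + 3) * q / p + 3 with hs
  set C₂' : ℝ := max C₂ 0 with hC₂'
  have hC₂' : 0 ≤ C₂' := le_max_right _ _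
  have hC₂le : C₂ ≤ C₂' := le_max_left _ _
  have hδ0 : 0 < |δ| := abs_pos.2 hδ
  set lam : ℝ := |δ| ^ ((r' + 3) / p) with hlam
  have hlampos : 0 < lam := by rw [hlam]; exact Real.rpow_pos_of_pos hδ0 _
  have hlam_p : lam ^ p = |δ| ^ (r' + 3) := by
    rw [hlam, ← Real.rpow_mul hδ0.le]
    congr 1
    field_simp
  have hlam_q : (1 / lam) ^ q = |δ| ^ (-((r' + 3) * q / p)) := by
    rw [hlam, one_div, ← Real.rpow_neg hδ0.le, ← Real.rpow_mul hδ0.le]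
    congr 1
    ring
  obtain ⟨h1, hyoung⟩ :=
    setIntegral_abs_mul_exp_le_young μ₀ hpq hlampos hφm hexp hT2.1
      {x : PhaseSpace N | η < |φ x - φ (x.1, -x.2)|}
  refine ⟨h1, ?_⟩
  have hA' : lam ^ p / p * (C₂ * |δ| ^ (-r)) ≤ C₂' / p * (|δ| * δ ^ 2) := by
    rw [hlam_p]
    have h1' : C₂ * |δ| ^ (-r) ≤ C₂' * |δ| ^ (-r') :=
      calc C₂ * |δ| ^ (-r) ≤ C₂' * |δ| ^ (-r) :=
            mul_le_mul_of_nonneg_right hC₂le (Real.rpow_nonneg hδ0.le _)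
        _ ≤ C₂' * |δ| ^ (-r') := mul_le_mul_of_nonneg_left
            (Real.rpow_le_rpow_of_exponent_ge hδ0 hδ1.le (neg_le_neg hrr')) hC₂'
    have h2' : |δ| ^ (r' + 3) * |δ| ^ (-r') = |δ| * δ ^ 2 := by
      rw [← Real.rpow_add hδ0]
      have : r' + 3 + -r' = ((3 : ℕ) : ℝ) := by push_cast; ring
      rw [this, Real.rpow_natCast, ← sq_abs δ]
      ring
    have h3' : 0 ≤ |δ| ^ (r' + 3) / p := by positivity
    calc |δ| ^ (r' + 3) / p * (C₂ * |δ| ^ (-r)) ≤ |δ| ^ (r' + 3) / p * (C₂' * |δ| ^ (-r')) :=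
          mul_le_mul_of_nonneg_left h1' h3'
      _ = C₂' / p * (|δ| ^ (r' + 3) * |δ| ^ (-r')) := by ring
      _ = C₂' / p * (|δ| * δ ^ 2) := by rw [h2']
  have hB' : (1 / lam) ^ q / q * |δ| ^ s = 1 / q * (|δ| * δ ^ 2) := by
    rw [hlam_q]
    have h2' : |δ| ^ (-((r' + 3) * q / p)) * |δ| ^ s = |δ| * δ ^ 2 := by
      rw [← Real.rpow_add hδ0]
      have : -((r' + 3) * q / p) + s = ((3 : ℕ) : ℝ) := by rw [hs]; push_cast; ring
      rw [this, Real.rpow_natCast, ← sq_abs δ]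
      ring
    calc |δ| ^ (-((r' + 3) * q / p)) / q * |δ| ^ s
        = 1 / q * (|δ| ^ (-((r' + 3) * q / p)) * |δ| ^ s) := by ring
      _ = 1 / q * (|δ| * δ ^ 2) := by rw [h2']
  have hc1 : 0 ≤ lam ^ p / p := by positivity
  have hc2 : 0 ≤ (1 / lam) ^ q / q := by positivity
  have htail : ∫ x in {x | η < |φ x - φ (x.1, -x.2)|}, |φ x - φ (x.1, -x.2)| *
      exp (φ x) ∂μ₀ ≤ C₂' / p * (|δ| * δ ^ 2) + 1 / q * (|δ| * δ ^ 2) := by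
    refine hyoung.trans ?_
    rw [← hB']
    exact add_le_add ((mul_le_mul_of_nonneg_left hT2.2 hc1).trans hA')
      (mul_le_mul_of_nonneg_left hS hc2)
  have h3' : (C₂' / p + 1 / q) * |δ| * δ ^ 2 ≤ ε * δ ^ 2 :=
    mul_le_mul_of_nonneg_right hsmall (sq_nonneg δ)
  nlinarith [htail, h3']

end Tails

end Summit.AtomisticToContinuum.FouriersLaw.Theorems.ExtensiveSnapshotIrreversibility.EnergyWindow

end
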